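import Summits.QuantumFields.BalabanUV.T4Continuum.Support.VariationalVectorEndOfLeaves
import Summits.QuantumFields.BalabanUV.T4Continuum.Support.VariationalMonotoneTower

/-!
# T⁴ programme, spine node NE2 (U1a), lane P2 — THE MONOTONE END: EXISTENCE of the vector tower limit from the UPPER bracket alone
# ((ONE-min) + V-REG + V-P + V-UB; no slice law, no Federbush, no rate) (model level; cell `pub-balaban`)

NE2 formalisation swarm `b2b-balaban-t4-ne2-formalise-*`, leaf prover 10 GEN 3 (`prover-b2b-balaban-t4-ne2-formalise-leaf-10-g3-0`, V-END holder lineage); journal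
INTENT «THE MONOTONE END» CLAIMS.log 2026-08-20 16:10Z l.16875, module (M2); abstract part = (M1) `VariationalMonotoneTower`.

THE POINT.  The END of record (`VariationalVectorTower.towerLimitRate_effV_of_pairs` p218948 → `…EndOfLeaves` p220074 → `…EndOfLeavesSlice` p221732 → `…EndOfLeavesMin`)
converts TWO-SIDED per-level brackets with GEOMETRIC defects into `TowerLimitRate`.  With background the LOWER bracket is where the trouble sits: the slice law (SLICE) as
typed is a located obstruction and (SLICE-min) an open leaf with a measured non-decaying multiplicative constant (leaf-01-g7's memo `t4/T4-EST-NE2-P2-VGF.md` §5 (V1),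
(V2)); the curl Federbush lives there too.  The UPPER bracket of `VariationalAssemblySliceMin.pair_bracket_sqrt_min` (p224582) uses ONLY the coarse minimiser, leaf V-ONE
in its (ONE-min) form, V-REG, V-P (coarse) and V-UB (coarse), and says, level by level, `Δ_{k+1}(φ) ≤ Δ_k(φ) + e′_k·‖φ‖²` — in the Loewner order `X_{k+1} ≤ X_k + e′_k`
for the Hermitian effective operators `X_k = effV (L^k) M (R k) (Gm k) (QmL (L^k) M (T k)) a` (`Δ_k(φ) = re⟨unc φ, X_k unc φ⟩`, `VariationalVectorEffective.blockSpin_ScV_eq`).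
Since `X_k ≥ 0`, (M1) applies:
 * §1 **`upper_bracket_of_oneMin`** (abstract `blockSpin` level) and **`vector_upper_bracket_min`** (vector letters, ANY one-step map `Q₁`): the upper half of p224582's
   bracket under its upper-half hypotheses only — `blockSpin (Qk ∘ Q₁) Sf μ ≤ blockSpin Qk Sc μ + e′·qZ μ`, `e′ = ePV Λ C_P C_R ε₁ δ′` VERBATIM.
 * §2 **`effV_tendsto_of_upper`**: along `n_k = L^k` with the END's structural binders (`Gm k` PSD, `G k = qform (Gm k) ∘ unc`, COMP DATA identities `hTcomp` ∕ `hRtr` ∕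
   `hGtr`), V-UB (coarse), V-P (coarse), V-REG and (ONE-min) per level, nonnegative constants and BOUNDED PARTIAL SUMS `Σ_{k<K} ePV (Λ k) (C_P k) (C_R k) (ε₁ k) (δ′ k) ≤ S`:
   `∃ X∞, Tendsto (k ↦ effV (L^k) M (R k) (Gm k) (QmL (L^k) M (T k)) a) atTop (𝓝 X∞)`, `X∞` Hermitian with nonnegative form, the block-spin values converge
   `Δ_k(φ) → re⟨unc φ, X∞ unc φ⟩`, and **`tv_blockSpin_le`**: `Σ_{k<K} |Δ_k(φ) − Δ_{k+1}(φ)| ≤ (Λ 0 + 2S)·‖φ‖²` (absolutely summable increments as forms).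
   **NO `hslice`, NO `hFEDcurl`, NO fine-level `hUBf` ∕ `hPf`, NO contractivity of `T′ k`, NO RATE.**
 * §3 **`effV_tendsto_of_upper_geom`**: the same under the END's usual uniform constants and geometric decay `ε₁ k ≤ c_ε θ^k`, `δ′ k ≤ c_δ′ θ^k`, `0 ≤ θ < 1`
   (`S = ePV Λ⋆ C_P⋆ C_R⋆ c_ε c_δ′ ∕ (1 − θ)` by p220074's `ePV_level_le`).
 * §4 (v1.1) **`effV_tendsto_of_bracket`**: the UPPER BRACKETS THEMSELVES (`Δ_{k+1}(φ) ≤ Δ_k(φ) + e k·‖φ‖²`, `Σ e ≤ S`) as the hypothesis — for suppliers who reach the bracket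
   by another route (V-ONE's curl competitor + a fine-level slice move); only `Gm k` PSD, `G k = qform ∘ unc`, `QvL (T k)` onto and coarse V-P beside it; same conclusions + the
   total-variation bound.
READING.  The existence half of the vector END with background thus reduces to (ONE-min) (memo (V5): V-ONE's curl half is landed — p221498, leaf-04-g4's taxi p221223 — plus a
FINE-level slice-type law at those competitors, OPEN) + V-REG (leaf-03-g5's (C) p222597 ∕ (G) p224635 under displayed (Går) ∕ V-P ∕ V-UB) + decay of `ε₁, δ′`; the slice law and
the curl Federbush are needed only for the RATE.  At `U = 1` everything including the rate is already a theorem (`VariationalVectorEndFlatMin`).  WITH background, leaf-01-g7's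
direct two-level numerics (FINDING F-ne2leaf01g7-2, memo v1.1 §3e–§3g; d = 2, U(1) toy, n ≤ 32) measure the UPPER-direction defect `λ_max(X_{2n} − X_n)` = the flat values
(24.9, 10.8, 3.19, 0.83 at n = 2, 4, 8, 16), decaying like `L^{−2k}` — the summable shape this file displays — while the located level-independent plateau `≈ 0.16c²` sits in the
LOWER direction (`λ_max(X_n − X_{2n})`, the Federbush ∕ slice side), which the monotone route does not use.  Numerics, not a theorem; recorded as the reason for this design.

HONEST FRAMING (T4-DAG p. 1).  Model level, `E = ℂ`; transports ∕ forms ∕ functionals DATA (c5); [folklore] plumbing over tree theorems imported BY NAME; every leaf DISPLAYED,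
none discharged; nothing printed is a hypothesis; no `def`, no `def … : Prop`, no `sorry`; axioms standard.  V-GF with background OPEN; V-END with background ∕ NE2 NOT proved;
NE3 OPEN; spine PROVED 0∕9 unchanged; rung (B)+1 on a fixed finite T⁴ — NOT infinite volume, NOT mass gap, NOT Clay.  HONEST DEPENDENCY (cell, verbatim): continuum YM on
T⁴ ⇐ BetaPertH ∧ nine spine estimates (0/9 proved); BetaPertH ⇐ (D1) ∧ (D4) ∧ CAP+tail; G-an2-4 gates asym, D1 and NE2/3/4.
-/

noncomputable section

namespace Summit.QuantumFields.BalabanUV.T4Continuum.VariationalVectorEndMonotone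

open Finset Filter
open scoped Matrix ComplexConjugate ComplexOrder BigOperators Topology
open Literature.MathematicalPhysics.QuantumFieldTheory.Balaban1983to89.B5Prop11Plancherel (Tor fine unitVec)
open Literature.Analysis.Complex (qform)
open Summit.QuantumFields.BalabanUV.T4Continuum.VariationalTransfer (blockSpin blockSpin_le blockSpin_eq_of_isMin blockSpin_nonneg')
open Summit.QuantumFields.BalabanUV.T4Continuum.VariationalCovariantAssembly (exists_isMinOn_fib defect_bound)
open Summit.QuantumFields.BalabanUV.T4Continuum.VariationalColourTower (Rtrv)
open Summit.QuantumFields.BalabanUV.T4Continuum.VectorBlockTrialForm (nsqV nsqV_nonneg QvL compL)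
open Summit.QuantumFields.BalabanUV.T4Continuum.VariationalVectorForm
open Summit.QuantumFields.BalabanUV.T4Continuum.VariationalVectorEffective (unc cur unc_cur nsq_unc effV effV_isHermitian blockSpin_ScV_eq)
open Summit.QuantumFields.BalabanUV.T4Continuum.VariationalVectorAverage (continuous_QvL)
open Summit.QuantumFields.BalabanUV.T4Continuum.VariationalVectorTower
  (Gtr QmL avg_QmL avg_QmL_eq QmL_mulVec_surjective QvL_surjective_of_ub blockSpin_vector_pair_transport)
open Summit.QuantumFields.BalabanUV.T4Continuum.VariationalVectorEndOfLeaves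
  (ePV ePV_nonneg ePV_level_le nonneg_of_qform continuous_of_qform nonneg_of_Gtr continuous_of_Gtr)
open Summit.QuantumFields.BalabanUV.T4Continuum.VariationalMonotoneTower (exists_tendsto_of_upper_brackets tv_qform_le)

/-! ## §1 The upper bracket alone -/

section Abstract

variable {V W Z : Type*} [NormedAddCommGroup W] [ProperSpace W] [TopologicalSpace Z] [T1Space Z]

/-- **THE UPPER BRACKET UNDER ITS OWN HYPOTHESES** (the upper half of `VariationalAssemblySliceMin.pair_bracket_sqrt_min`, p224582, same arithmetic): a coarse minimiser
(V-P coercivity + V-UB non-emptiness), leaf ONE at that minimiser INTO THE COMPOSITE FIBRE ((ONE-min)), V-REG and V-P at the minimiser give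
`blockSpin (Qk ∘ Q₁) Sf μ ≤ blockSpin Qk Sc μ + e′·qZ μ`, `e′ = ε₁C_R(Λ+1) + 2δ′√((Λ + ε₁C_R(Λ+1))·C_P(Λ+1)) + δ′²C_P(Λ+1)`.  No slice law, no Federbush, nothing at
the fine level but `0 ≤ Sf`. [folklore] -/
theorem upper_bracket_of_oneMin
    {Qk : W → Z} {Q₁ : V → W} {Sc : W → ℝ} {Sf : V → ℝ} {qW : W → ℝ} {qZ : Z → ℝ} {ρ : W → ℝ}
    (hQk : Continuous Qk) (hSc : Continuous Sc) (hSc0 : ∀ f, 0 ≤ Sc f) (hSf0 : ∀ f', 0 ≤ Sf f') (hqW0 : ∀ f, 0 ≤ qW f) (hqZ0 : ∀ μ, 0 ≤ qZ μ)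
    (hρ0 : ∀ f, 0 ≤ ρ f)
    {κ Λ CP CR ε₁ δ' : ℝ} (hκ : 0 ≤ κ) (hΛ : 0 ≤ Λ) (hCP : 0 ≤ CP) (hCR : 0 ≤ CR) (hε₁ : 0 ≤ ε₁) (hδ' : 0 ≤ δ')
    (hnormW : ∀ f, ‖f‖ ^ 2 ≤ κ * qW f)
    (hUBc : ∀ μ, ∃ f, Qk f = μ ∧ Sc f ≤ Λ * qZ μ)
    (hPc : ∀ f, qW f ≤ CP * (Sc f + qZ (Qk f)))
    (hONEm : ∀ μ f₀, Qk f₀ = μ → (∀ f, Qk f = μ → Sc f₀ ≤ Sc f) →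
      ∃ g, Qk (Q₁ g) = μ ∧ Sf g ≤ (Real.sqrt (Sc f₀ + ε₁ * ρ f₀) + δ' * Real.sqrt (qW f₀)) ^ 2)
    (hREG : ∀ μ f, Qk f = μ → (∀ g, Qk g = μ → Sc f ≤ Sc g) → ρ f ≤ CR * (Sc f + qZ μ))
    (μ : Z) :
    blockSpin (Qk ∘ Q₁) Sf μ ≤ blockSpin Qk Sc μ
        + (ε₁ * CR * (Λ + 1) + 2 * δ' * Real.sqrt ((Λ + ε₁ * CR * (Λ + 1)) * (CP * (Λ + 1))) + δ' ^ 2 * (CP * (Λ + 1))) * qZ μ := by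
  -- the coarse minimiser (P coercivity + UB nonemptiness)
  obtain ⟨fU, hfU, hfUb⟩ := hUBc μ
  obtain ⟨f₀, hf₀, hmin⟩ := exists_isMinOn_fib (qZ := qZ) hQk hSc hκ hCP hnormW hPc hfU
  have hSc_le : Sc f₀ ≤ Λ * qZ μ := (hmin fU hfU).trans hfUb
  have hqW_le : qW f₀ ≤ CP * (Λ + 1) * qZ μ := by
    calc qW f₀ ≤ CP * (Sc f₀ + qZ (Qk f₀)) := hPc f₀
      _ ≤ CP * (Λ * qZ μ + qZ μ) := by rw [hf₀]; gcongr
      _ = CP * (Λ + 1) * qZ μ := by ring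
  have hρ_le : ρ f₀ ≤ CR * (Λ + 1) * qZ μ := by
    calc ρ f₀ ≤ CR * (Sc f₀ + qZ μ) := hREG μ f₀ hf₀ hmin
      _ ≤ CR * (Λ * qZ μ + qZ μ) := by gcongr
      _ = CR * (Λ + 1) * qZ μ := by ring
  -- ONE at the coarse minimiser, into the composite fibre: the square-root shape becomes an additive defect `e′·qZ μ`
  obtain ⟨g₁, hg₁, hONE₁⟩ := hONEm μ f₀ hf₀ hmin
  have hc : Sf g₁ ≤ Sc f₀
      + (ε₁ * CR * (Λ + 1) + 2 * δ' * Real.sqrt ((Λ + ε₁ * CR * (Λ + 1)) * (CP * (Λ + 1))) + δ' ^ 2 * (CP * (Λ + 1))) * qZ μ := by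
    have h := hONE₁
    have hs0 : 0 ≤ Sc f₀ + ε₁ * ρ f₀ := add_nonneg (hSc0 f₀) (mul_nonneg hε₁ (hρ0 f₀))
    have hs : Sc f₀ + ε₁ * ρ f₀ ≤ (Λ + ε₁ * CR * (Λ + 1)) * qZ μ := by
      nlinarith [hSc_le, mul_le_mul_of_nonneg_left hρ_le hε₁]
    have hΛ' : 0 ≤ Λ + ε₁ * CR * (Λ + 1) := by positivity
    have hdef := defect_bound (s := Sc f₀ + ε₁ * ρ f₀) (v := qW f₀) (z := qZ μ) (Λ := Λ + ε₁ * CR * (Λ + 1)) (P := CP * (Λ + 1))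
      hδ' hΛ' (by positivity) (hqZ0 μ) hs hqW_le
    rw [add_sq, Real.sq_sqrt hs0, mul_pow, Real.sq_sqrt (hqW0 f₀)] at h
    have hρ' : ε₁ * ρ f₀ ≤ ε₁ * CR * (Λ + 1) * qZ μ := by nlinarith [mul_le_mul_of_nonneg_left hρ_le hε₁]
    linarith
  rw [blockSpin_eq_of_isMin hSc0 hf₀ hmin]
  have hg₁' : (Qk ∘ Q₁) g₁ = μ := by simpa using hg₁
  exact (blockSpin_le hSf0 hg₁').trans hc

end Abstract

section Vector

variable {d : ℕ} (n L : ℕ) [NeZero n] [NeZero L] (M : Fin d → ℕ) [hM : ∀ μ, NeZero (M μ)]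

/-- **THE UPPER BRACKET, VECTOR LETTERS** (`E = ℂ`, ANY one-step map `Q₁` into the level-`n` fields — no contractivity, no surjectivity): `Sc := ScV R G`, `Sf := SfV R′ G′`,
`qW := qWV`, `qZ := nsqV M`; the norm∕size comparison `‖W‖² ≤ n^d·qWV W` discharged. [folklore] -/
theorem vector_upper_bracket_min
    {R : Tor (fine n M) → Fin d → (ℂ →L[ℂ] ℂ)} {R' : Tor (fine L (fine n M)) → Fin d → (ℂ →L[ℂ] ℂ)}
    {G : (Tor (fine n M) → Fin d → ℂ) → ℝ} {G' : (Tor (fine L (fine n M)) → Fin d → ℂ) → ℝ}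
    {Qk : (Tor (fine n M) → Fin d → ℂ) → (Tor M → Fin d → ℂ)} {Q₁ : (Tor (fine L (fine n M)) → Fin d → ℂ) → (Tor (fine n M) → Fin d → ℂ)}
    (hQk : Continuous Qk) (hG0 : ∀ W, 0 ≤ G W) (hGc : Continuous G) (hG0' : ∀ W', 0 ≤ G' W')
    {Λ CP CR ε₁ δ' : ℝ} (hΛ : 0 ≤ Λ) (hCP : 0 ≤ CP) (hCR : 0 ≤ CR) (hε₁ : 0 ≤ ε₁) (hδ' : 0 ≤ δ')
    {ρ : (Tor (fine n M) → Fin d → ℂ) → ℝ} (hρ0 : ∀ W, 0 ≤ ρ W)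
    (hUBc : ∀ φ : Tor M → Fin d → ℂ, ∃ W, Qk W = φ ∧ ScV n M R G W ≤ Λ * nsqV M φ)
    (hPc : ∀ W, qWV n M W ≤ CP * (ScV n M R G W + nsqV M (Qk W)))
    (hONEm : ∀ (φ : Tor M → Fin d → ℂ) (W₀ : Tor (fine n M) → Fin d → ℂ), Qk W₀ = φ → (∀ W, Qk W = φ → ScV n M R G W₀ ≤ ScV n M R G W) →
      ∃ g, Qk (Q₁ g) = φ ∧ SfV n L M R' G' g ≤ (Real.sqrt (ScV n M R G W₀ + ε₁ * ρ W₀) + δ' * Real.sqrt (qWV n M W₀)) ^ 2)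
    (hREG : ∀ (φ : Tor M → Fin d → ℂ) W, Qk W = φ → (∀ W₂, Qk W₂ = φ → ScV n M R G W ≤ ScV n M R G W₂) →
      ρ W ≤ CR * (ScV n M R G W + nsqV M φ))
    (φ : Tor M → Fin d → ℂ) :
    blockSpin (Qk ∘ Q₁) (SfV n L M R' G') φ ≤ blockSpin Qk (ScV n M R G) φ + ePV Λ CP CR ε₁ δ' * nsqV M φ := by
  have hn0 : (0 : ℝ) < (n : ℝ) ^ d := by have := Nat.pos_of_ne_zero (NeZero.ne n); positivity
  have hnormW : ∀ W : Tor (fine n M) → Fin d → ℂ, ‖W‖ ^ 2 ≤ (n : ℝ) ^ d * qWV n M W := fun W => by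
    unfold qWV
    rw [← mul_assoc, mul_inv_cancel₀ hn0.ne', one_mul]
    exact norm_sq_le_nsqV W
  unfold ePV
  exact upper_bracket_of_oneMin (Qk := Qk) (Q₁ := Q₁) (Sc := ScV n M R G) (Sf := SfV n L M R' G') (qW := qWV n M) (qZ := nsqV M) (ρ := ρ)
    hQk (continuous_ScV n M R hGc) (ScV_nonneg n M R hG0) (SfV_nonneg n L M R' hG0') (qWV_nonneg n M) (nsqV_nonneg M) hρ0
    hn0.le hΛ hCP hCR hε₁ hδ' hnormW hUBc hPc hONEm hREG φ

end Vector

/-! ## §2 The monotone END: existence of the tower limit from the upper bracket -/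

section Tower

variable {d : ℕ} (L : ℕ) [NeZero L] (M : Fin d → ℕ) [hM : ∀ μ, NeZero (M μ)]
variable (R : (k : ℕ) → Tor (fine (L ^ k) M) → Fin d → (ℂ →L[ℂ] ℂ))
variable (R' : (k : ℕ) → Tor (fine L (fine (L ^ k) M)) → Fin d → (ℂ →L[ℂ] ℂ))
variable (Gm : (k : ℕ) → Matrix (Tor (fine (L ^ k) M) × Fin d) (Tor (fine (L ^ k) M) × Fin d) ℂ)
variable (G : (k : ℕ) → (Tor (fine (L ^ k) M) → Fin d → ℂ) → ℝ)
variable (G' : (k : ℕ) → (Tor (fine L (fine (L ^ k) M)) → Fin d → ℂ) → ℝ)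
variable (T : (k : ℕ) → Tor M → (Fin d → Fin (L ^ k)) → Fin (L ^ k) → Fin d → (ℂ →L[ℂ] ℂ))
variable (T' : (k : ℕ) → Tor (fine (L ^ k) M) → (Fin d → Fin L) → Fin L → Fin d → (ℂ →L[ℂ] ℂ))

/-- **THE MONOTONE END — EXISTENCE OF THE VECTOR TOWER LIMIT FROM THE UPPER BRACKET ALONE.**  Along `n_k = L^k` with the END's structural binders, leaf V-UB (coarse), leaf V-P
(coarse), leaf V-REG and leaf V-ONE in its (ONE-min) form at every level, nonnegative constants, and BOUNDED PARTIAL SUMS of the upper defects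
`Σ_{k<K} ePV (Λ k) (C_P k) (C_R k) (ε₁ k) (δ′ k) ≤ S`: the Hermitian effective operators `X_k = effV (L^k) M (R k) (Gm k) (QmL (L^k) M (T k)) a` CONVERGE, the limit is Hermitian
with nonnegative form, and every block-spin value `Δ_k(φ) = blockSpin (QvL (T k)) (ScV (R k) (G k)) φ` converges to the limit's form.  NO slice law, NO Federbush, NO fine-level
V-UB ∕ V-P, NO contractivity of `T′ k`, NO rate. [folklore] -/
theorem effV_tendsto_of_upper (hGm : ∀ k, (Gm k).PosSemidef) (hG : ∀ k W, G k W = qform (Gm k) (unc W))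
    (hTcomp : ∀ k, T (k + 1) = compL (L ^ k) L M (T k) (T' k)) (hRtr : ∀ k, R (k + 1) = Rtrv (L ^ k) L M (R' k))
    (hGtr : ∀ k, G (k + 1) = Gtr (L ^ k) L M (G' k))
    {a : ℝ} (ha : 0 < a)
    (Λ CP CR ε₁ δ' : ℕ → ℝ) {S : ℝ}
    (hΛ : ∀ k, 0 ≤ Λ k) (hCP : ∀ k, 0 ≤ CP k) (hCR : ∀ k, 0 ≤ CR k) (hε₁ : ∀ k, 0 ≤ ε₁ k) (hδ' : ∀ k, 0 ≤ δ' k)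
    (hS : ∀ K, ∑ k ∈ range K, ePV (Λ k) (CP k) (CR k) (ε₁ k) (δ' k) ≤ S)
    {ρV : (k : ℕ) → (Tor (fine (L ^ k) M) → Fin d → ℂ) → ℝ} (hρ0 : ∀ k W, 0 ≤ ρV k W)
    -- leaf V-UB and leaf V-P at the COARSE level only
    (hUBc : ∀ k (φ : Tor M → Fin d → ℂ), ∃ W, QvL (L ^ k) M (T k) W = φ ∧ ScV (L ^ k) M (R k) (G k) W ≤ Λ k * nsqV M φ)
    (hPc : ∀ k W, qWV (L ^ k) M W ≤ CP k * (ScV (L ^ k) M (R k) (G k) W + nsqV M (QvL (L ^ k) M (T k) W)))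
    -- leaf V-ONE AT COARSE MINIMISERS INTO THE COMPOSITE FIBRE, and leaf V-REG
    (hONEm : ∀ k (φ : Tor M → Fin d → ℂ) (W₀ : Tor (fine (L ^ k) M) → Fin d → ℂ), QvL (L ^ k) M (T k) W₀ = φ →
      (∀ W, QvL (L ^ k) M (T k) W = φ → ScV (L ^ k) M (R k) (G k) W₀ ≤ ScV (L ^ k) M (R k) (G k) W) →
      ∃ g, QvL (L ^ k) M (T k) (QvL L (fine (L ^ k) M) (T' k) g) = φ ∧
        SfV (L ^ k) L M (R' k) (G' k) g ≤ (Real.sqrt (ScV (L ^ k) M (R k) (G k) W₀ + ε₁ k * ρV k W₀) + δ' k * Real.sqrt (qWV (L ^ k) M W₀)) ^ 2)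
    (hREG : ∀ k (φ : Tor M → Fin d → ℂ) W, QvL (L ^ k) M (T k) W = φ →
      (∀ W₂, QvL (L ^ k) M (T k) W₂ = φ → ScV (L ^ k) M (R k) (G k) W ≤ ScV (L ^ k) M (R k) (G k) W₂) →
      ρV k W ≤ CR k * (ScV (L ^ k) M (R k) (G k) W + nsqV M φ)) :
    ∃ Xlim : Matrix (Tor M × Fin d) (Tor M × Fin d) ℂ,
      Tendsto (fun k => effV (L ^ k) M (R k) (Gm k) (QmL (L ^ k) M (T k)) a) atTop (𝓝 Xlim) ∧ Xlim.IsHermitian ∧ (∀ v, 0 ≤ qform Xlim v) ∧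
      ∀ φ : Tor M → Fin d → ℂ, Tendsto (fun k => blockSpin (QvL (L ^ k) M (T k)) (ScV (L ^ k) M (R k) (G k)) φ) atTop (𝓝 (qform Xlim (unc φ))) := by
  -- (GF0) and continuity at every level, from the matrix form and one step up through `Gtr`
  have hG0 : ∀ k W, 0 ≤ G k W := fun k => nonneg_of_qform (L ^ k) M (hGm k) (hG k)
  have hGc : ∀ k, Continuous (G k) := fun k => continuous_of_qform (L ^ k) M (hG k)
  have hG0' : ∀ k W', 0 ≤ G' k W' := fun k => nonneg_of_Gtr (L ^ k) L M (hGtr k) (hG0 (k + 1))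
  -- the matrix averaging: onto, and V-P in its letters
  have hQ : ∀ k, Function.Surjective (QmL (L ^ k) M (T k)).mulVec := fun k => QmL_mulVec_surjective _ _ (QvL_surjective_of_ub (L ^ k) M (hUBc k))
  have hP' : ∀ k W, qWV (L ^ k) M W ≤ CP k * (ScV (L ^ k) M (R k) (G k) W
      + nsqV M (VariationalVectorEffective.avg (L ^ k) M (QmL (L ^ k) M (T k)) W)) := fun k W => by
    rw [avg_QmL]; exact hPc k W
  -- block-spin values are the forms of the effective operators
  have hΔ : ∀ k φ, blockSpin (QvL (L ^ k) M (T k)) (ScV (L ^ k) M (R k) (G k)) φ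
      = qform (effV (L ^ k) M (R k) (Gm k) (QmL (L ^ k) M (T k)) a) (unc φ) := fun k φ => by
    rw [← avg_QmL_eq]; exact blockSpin_ScV_eq (L ^ k) M (R k) (hGm k) (hG k) (hQ k) (hP' k) ha φ
  -- the upper bracket per level, transported to the level-`k+1` presentation
  have hup : ∀ k φ, blockSpin (QvL (L ^ (k + 1)) M (T (k + 1))) (ScV (L ^ (k + 1)) M (R (k + 1)) (G (k + 1))) φ
      ≤ blockSpin (QvL (L ^ k) M (T k)) (ScV (L ^ k) M (R k) (G k)) φ + ePV (Λ k) (CP k) (CR k) (ε₁ k) (δ' k) * nsqV M φ := fun k φ => by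
    have hlev : blockSpin (QvL (L ^ (k + 1)) M (T (k + 1))) (ScV (L ^ (k + 1)) M (R (k + 1)) (G (k + 1))) φ
        = blockSpin (QvL (L ^ k * L) M (compL (L ^ k) L M (T k) (T' k))) (ScV (L ^ k * L) M (Rtrv (L ^ k) L M (R' k)) (Gtr (L ^ k) L M (G' k))) φ := by
      rw [hTcomp k, hRtr k, hGtr k]; rfl
    rw [hlev, ← blockSpin_vector_pair_transport]
    exact vector_upper_bracket_min (L ^ k) L M (continuous_QvL (L ^ k) M (T k)) (hG0 k) (hGc k) (hG0' k) (hΛ k) (hCP k) (hCR k) (hε₁ k) (hδ' k)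
      (hρ0 k) (hUBc k) (hPc k) (hONEm k) (hREG k) φ
  -- (M1): the monotone tower of Hermitian effective operators
  have hX : ∀ k, (effV (L ^ k) M (R k) (Gm k) (QmL (L ^ k) M (T k)) a).IsHermitian := fun k =>
    effV_isHermitian (L ^ k) M (R k) (hGm k) (hG k) (hQ k) (hP' k) ha
  have hpos : ∀ k v, 0 ≤ qform (effV (L ^ k) M (R k) (Gm k) (QmL (L ^ k) M (T k)) a) v := fun k v => by
    rw [← unc_cur v, ← hΔ]
    exact blockSpin_nonneg' (ScV_nonneg (L ^ k) M (R k) (hG0 k))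
  have hstep : ∀ k v, qform (effV (L ^ (k + 1)) M (R (k + 1)) (Gm (k + 1)) (QmL (L ^ (k + 1)) M (T (k + 1))) a) v
      ≤ qform (effV (L ^ k) M (R k) (Gm k) (QmL (L ^ k) M (T k)) a) v + ePV (Λ k) (CP k) (CR k) (ε₁ k) (δ' k) * nsqV M (cur v) := fun k v => by
    rw [← unc_cur v, ← hΔ, ← hΔ]
    exact hup k (cur v)
  obtain ⟨Xlim, hT, hH, hnn, hform⟩ := exists_tendsto_of_upper_brackets (fun k => effV (L ^ k) M (R k) (Gm k) (QmL (L ^ k) M (T k)) a) hX hpos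
    (N := fun v => nsqV M (cur v)) (fun v => nsqV_nonneg M (cur v)) (e := fun k => ePV (Λ k) (CP k) (CR k) (ε₁ k) (δ' k))
    (fun k => ePV_nonneg (hΛ k) (hCP k) (hCR k) (hε₁ k) (hδ' k)) hS hstep
  refine ⟨Xlim, hT, hH, hnn, fun φ => ?_⟩
  have e1 : (fun k => blockSpin (QvL (L ^ k) M (T k)) (ScV (L ^ k) M (R k) (G k)) φ)
      = fun k => qform (effV (L ^ k) M (R k) (Gm k) (QmL (L ^ k) M (T k)) a) (unc φ) := funext fun k => hΔ k φ
  rw [e1]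
  exact hform (unc φ)

/-- **BOUNDED TOTAL VARIATION OF THE BLOCK-SPIN VALUES** along the tower, under the same (upper-bracket) hypotheses:
`Σ_{k<K} |Δ_k(φ) − Δ_{k+1}(φ)| ≤ (Λ 0 + 2S)·nsqV φ` — the increments are absolutely summable as forms (no rate). [folklore] -/
theorem tv_blockSpin_le (hGm : ∀ k, (Gm k).PosSemidef) (hG : ∀ k W, G k W = qform (Gm k) (unc W))
    (hTcomp : ∀ k, T (k + 1) = compL (L ^ k) L M (T k) (T' k)) (hRtr : ∀ k, R (k + 1) = Rtrv (L ^ k) L M (R' k))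
    (hGtr : ∀ k, G (k + 1) = Gtr (L ^ k) L M (G' k))
    (Λ CP CR ε₁ δ' : ℕ → ℝ) {S : ℝ}
    (hΛ : ∀ k, 0 ≤ Λ k) (hCP : ∀ k, 0 ≤ CP k) (hCR : ∀ k, 0 ≤ CR k) (hε₁ : ∀ k, 0 ≤ ε₁ k) (hδ' : ∀ k, 0 ≤ δ' k)
    (hS : ∀ K, ∑ k ∈ range K, ePV (Λ k) (CP k) (CR k) (ε₁ k) (δ' k) ≤ S)
    {ρV : (k : ℕ) → (Tor (fine (L ^ k) M) → Fin d → ℂ) → ℝ} (hρ0 : ∀ k W, 0 ≤ ρV k W)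
    (hUBc : ∀ k (φ : Tor M → Fin d → ℂ), ∃ W, QvL (L ^ k) M (T k) W = φ ∧ ScV (L ^ k) M (R k) (G k) W ≤ Λ k * nsqV M φ)
    (hPc : ∀ k W, qWV (L ^ k) M W ≤ CP k * (ScV (L ^ k) M (R k) (G k) W + nsqV M (QvL (L ^ k) M (T k) W)))
    (hONEm : ∀ k (φ : Tor M → Fin d → ℂ) (W₀ : Tor (fine (L ^ k) M) → Fin d → ℂ), QvL (L ^ k) M (T k) W₀ = φ →
      (∀ W, QvL (L ^ k) M (T k) W = φ → ScV (L ^ k) M (R k) (G k) W₀ ≤ ScV (L ^ k) M (R k) (G k) W) →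
      ∃ g, QvL (L ^ k) M (T k) (QvL L (fine (L ^ k) M) (T' k) g) = φ ∧
        SfV (L ^ k) L M (R' k) (G' k) g ≤ (Real.sqrt (ScV (L ^ k) M (R k) (G k) W₀ + ε₁ k * ρV k W₀) + δ' k * Real.sqrt (qWV (L ^ k) M W₀)) ^ 2)
    (hREG : ∀ k (φ : Tor M → Fin d → ℂ) W, QvL (L ^ k) M (T k) W = φ →
      (∀ W₂, QvL (L ^ k) M (T k) W₂ = φ → ScV (L ^ k) M (R k) (G k) W ≤ ScV (L ^ k) M (R k) (G k) W₂) →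
      ρV k W ≤ CR k * (ScV (L ^ k) M (R k) (G k) W + nsqV M φ))
    (φ : Tor M → Fin d → ℂ) (K : ℕ) :
    ∑ k ∈ range K, |blockSpin (QvL (L ^ k) M (T k)) (ScV (L ^ k) M (R k) (G k)) φ
        - blockSpin (QvL (L ^ (k + 1)) M (T (k + 1))) (ScV (L ^ (k + 1)) M (R (k + 1)) (G (k + 1))) φ| ≤ (Λ 0 + 2 * S) * nsqV M φ := by
  have hG0 : ∀ k W, 0 ≤ G k W := fun k => nonneg_of_qform (L ^ k) M (hGm k) (hG k)
  have hGc : ∀ k, Continuous (G k) := fun k => continuous_of_qform (L ^ k) M (hG k)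
  have hG0' : ∀ k W', 0 ≤ G' k W' := fun k => nonneg_of_Gtr (L ^ k) L M (hGtr k) (hG0 (k + 1))
  have hup : ∀ k, blockSpin (QvL (L ^ (k + 1)) M (T (k + 1))) (ScV (L ^ (k + 1)) M (R (k + 1)) (G (k + 1))) φ
      ≤ blockSpin (QvL (L ^ k) M (T k)) (ScV (L ^ k) M (R k) (G k)) φ + ePV (Λ k) (CP k) (CR k) (ε₁ k) (δ' k) * nsqV M φ := fun k => by
    have hlev : blockSpin (QvL (L ^ (k + 1)) M (T (k + 1))) (ScV (L ^ (k + 1)) M (R (k + 1)) (G (k + 1))) φ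
        = blockSpin (QvL (L ^ k * L) M (compL (L ^ k) L M (T k) (T' k))) (ScV (L ^ k * L) M (Rtrv (L ^ k) L M (R' k)) (Gtr (L ^ k) L M (G' k))) φ := by
      rw [hTcomp k, hRtr k, hGtr k]; rfl
    rw [hlev, ← blockSpin_vector_pair_transport]
    exact vector_upper_bracket_min (L ^ k) L M (continuous_QvL (L ^ k) M (T k)) (hG0 k) (hGc k) (hG0' k) (hΛ k) (hCP k) (hCR k) (hε₁ k) (hδ' k)
      (hρ0 k) (hUBc k) (hPc k) (hONEm k) (hREG k) φ
  have h0 : ∀ k, 0 ≤ blockSpin (QvL (L ^ k) M (T k)) (ScV (L ^ k) M (R k) (G k)) φ := fun k =>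
    blockSpin_nonneg' (ScV_nonneg (L ^ k) M (R k) (hG0 k))
  have htv := VariationalMonotoneTower.tv_le_of_le_add (f := fun k => blockSpin (QvL (L ^ k) M (T k)) (ScV (L ^ k) M (R k) (G k)) φ)
    (e := fun k => ePV (Λ k) (CP k) (CR k) (ε₁ k) (δ' k) * nsqV M φ) (S := S * nsqV M φ) h0
    (fun k => mul_nonneg (ePV_nonneg (hΛ k) (hCP k) (hCR k) (hε₁ k) (hδ' k)) (nsqV_nonneg M φ))
    (fun K => by rw [← sum_mul]; exact mul_le_mul_of_nonneg_right (hS K) (nsqV_nonneg M φ)) hup K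
  -- `Δ_0(φ) ≤ Λ 0 · nsqV φ` by V-UB at level 0
  have hΔ0 : blockSpin (QvL (L ^ 0) M (T 0)) (ScV (L ^ 0) M (R 0) (G 0)) φ ≤ Λ 0 * nsqV M φ := by
    obtain ⟨W, hW, hWb⟩ := hUBc 0 φ
    exact (blockSpin_le (ScV_nonneg (L ^ 0) M (R 0) (hG0 0)) hW).trans hWb
  have : blockSpin (QvL (L ^ 0) M (T 0)) (ScV (L ^ 0) M (R 0) (G 0)) φ + 2 * (S * nsqV M φ) ≤ (Λ 0 + 2 * S) * nsqV M φ := by nlinarith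
  exact htv.trans this

/-! ## §3 The usual decay class -/

/-- **THE MONOTONE END UNDER THE END's USUAL DECAY CLASS**: uniform constants `Λ k ≤ Λ⋆`, `C_P k ≤ C_P⋆`, `C_R k ≤ C_R⋆` and geometric decay `ε₁ k ≤ c_ε θ^k`,
`δ′ k ≤ c_δ′ θ^k`, `0 ≤ θ < 1` give the bounded partial sums with `S = ePV Λ⋆ C_P⋆ C_R⋆ c_ε c_δ′ ∕ (1 − θ)`, hence the existence of the tower limit — with the SAME displayed
leaves as `effV_tendsto_of_upper` (coarse V-UB ∕ V-P, V-REG, (ONE-min)) and nothing else. [folklore] -/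
theorem effV_tendsto_of_upper_geom (hGm : ∀ k, (Gm k).PosSemidef) (hG : ∀ k W, G k W = qform (Gm k) (unc W))
    (hTcomp : ∀ k, T (k + 1) = compL (L ^ k) L M (T k) (T' k)) (hRtr : ∀ k, R (k + 1) = Rtrv (L ^ k) L M (R' k))
    (hGtr : ∀ k, G (k + 1) = Gtr (L ^ k) L M (G' k))
    {a : ℝ} (ha : 0 < a)
    (Λ CP CR ε₁ δ' : ℕ → ℝ) {Λs CPs CRs cε cδ' θ : ℝ}
    (hΛ : ∀ k, 0 ≤ Λ k) (hΛs : ∀ k, Λ k ≤ Λs) (hCP : ∀ k, 0 ≤ CP k) (hCPs : ∀ k, CP k ≤ CPs) (hCR : ∀ k, 0 ≤ CR k) (hCRs : ∀ k, CR k ≤ CRs)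
    (hε₁ : ∀ k, 0 ≤ ε₁ k) (hδ' : ∀ k, 0 ≤ δ' k) (hθ : 0 ≤ θ) (hθ1 : θ < 1)
    (hεθ : ∀ k, ε₁ k ≤ cε * θ ^ k) (hδ'θ : ∀ k, δ' k ≤ cδ' * θ ^ k)
    {ρV : (k : ℕ) → (Tor (fine (L ^ k) M) → Fin d → ℂ) → ℝ} (hρ0 : ∀ k W, 0 ≤ ρV k W)
    (hUBc : ∀ k (φ : Tor M → Fin d → ℂ), ∃ W, QvL (L ^ k) M (T k) W = φ ∧ ScV (L ^ k) M (R k) (G k) W ≤ Λ k * nsqV M φ)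
    (hPc : ∀ k W, qWV (L ^ k) M W ≤ CP k * (ScV (L ^ k) M (R k) (G k) W + nsqV M (QvL (L ^ k) M (T k) W)))
    (hONEm : ∀ k (φ : Tor M → Fin d → ℂ) (W₀ : Tor (fine (L ^ k) M) → Fin d → ℂ), QvL (L ^ k) M (T k) W₀ = φ →
      (∀ W, QvL (L ^ k) M (T k) W = φ → ScV (L ^ k) M (R k) (G k) W₀ ≤ ScV (L ^ k) M (R k) (G k) W) →
      ∃ g, QvL (L ^ k) M (T k) (QvL L (fine (L ^ k) M) (T' k) g) = φ ∧
        SfV (L ^ k) L M (R' k) (G' k) g ≤ (Real.sqrt (ScV (L ^ k) M (R k) (G k) W₀ + ε₁ k * ρV k W₀) + δ' k * Real.sqrt (qWV (L ^ k) M W₀)) ^ 2)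
    (hREG : ∀ k (φ : Tor M → Fin d → ℂ) W, QvL (L ^ k) M (T k) W = φ →
      (∀ W₂, QvL (L ^ k) M (T k) W₂ = φ → ScV (L ^ k) M (R k) (G k) W ≤ ScV (L ^ k) M (R k) (G k) W₂) →
      ρV k W ≤ CR k * (ScV (L ^ k) M (R k) (G k) W + nsqV M φ)) :
    ∃ Xlim : Matrix (Tor M × Fin d) (Tor M × Fin d) ℂ,
      Tendsto (fun k => effV (L ^ k) M (R k) (Gm k) (QmL (L ^ k) M (T k)) a) atTop (𝓝 Xlim) ∧ Xlim.IsHermitian ∧ (∀ v, 0 ≤ qform Xlim v) ∧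
      ∀ φ : Tor M → Fin d → ℂ, Tendsto (fun k => blockSpin (QvL (L ^ k) M (T k)) (ScV (L ^ k) M (R k) (G k)) φ) atTop (𝓝 (qform Xlim (unc φ))) := by
  -- the geometric envelope of the upper defects and its partial sums
  have hθ1' : θ ≤ 1 := hθ1.le
  have hcε : 0 ≤ cε := by have := (hε₁ 0).trans (hεθ 0); simpa using this
  have hcδ' : 0 ≤ cδ' := by have := (hδ' 0).trans (hδ'θ 0); simpa using this
  have hΛs0 : 0 ≤ Λs := (hΛ 0).trans (hΛs 0)
  have hCPs0 : 0 ≤ CPs := (hCP 0).trans (hCPs 0)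
  have hCRs0 : 0 ≤ CRs := (hCR 0).trans (hCRs 0)
  have hEP0 : 0 ≤ ePV Λs CPs CRs cε cδ' := ePV_nonneg hΛs0 hCPs0 hCRs0 hcε hcδ'
  have he' : ∀ k, ePV (Λ k) (CP k) (CR k) (ε₁ k) (δ' k) ≤ ePV Λs CPs CRs cε cδ' * θ ^ k := fun k =>
    ePV_level_le k (hΛ k) (hΛs k) (hCP k) (hCPs k) (hCR k) (hCRs k) (hε₁ k) hcε (hδ' k) hcδ' hθ hθ1' (hεθ k) (hδ'θ k)
  have hgeom : ∀ K, ∑ k ∈ range K, θ ^ k ≤ (1 - θ)⁻¹ := fun K => by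
    have h := geom_sum_Ico_le_of_lt_one (m := 0) (n := K) hθ hθ1
    rw [pow_zero, ← Finset.range_eq_Ico, one_div] at h
    exact h
  have hS : ∀ K, ∑ k ∈ range K, ePV (Λ k) (CP k) (CR k) (ε₁ k) (δ' k) ≤ ePV Λs CPs CRs cε cδ' / (1 - θ) := fun K => by
    calc ∑ k ∈ range K, ePV (Λ k) (CP k) (CR k) (ε₁ k) (δ' k) ≤ ∑ k ∈ range K, ePV Λs CPs CRs cε cδ' * θ ^ k := sum_le_sum fun k _ => he' k
      _ = ePV Λs CPs CRs cε cδ' * ∑ k ∈ range K, θ ^ k := by rw [mul_sum]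
      _ ≤ ePV Λs CPs CRs cε cδ' * (1 - θ)⁻¹ := mul_le_mul_of_nonneg_left (hgeom K) hEP0
      _ = ePV Λs CPs CRs cε cδ' / (1 - θ) := by rw [div_eq_mul_inv]
  exact effV_tendsto_of_upper L M R R' Gm G G' T T' hGm hG hTcomp hRtr hGtr ha Λ CP CR ε₁ δ' hΛ hCP hCR hε₁ hδ' hS hρ0 hUBc hPc hONEm hREG

/-! ## §4 (v1.1) The upper bracket AS SUCH as the hypothesis -/

/-- **THE MONOTONE END FROM THE UPPER BRACKET AS SUCH** (v1.1, for suppliers who prove the bracket by another route than (ONE-min) — e.g. V-ONE's curl competitor followed by a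
fine-level slice move): along `n_k = L^k`, with `Gm k` PSD, `G k = qform (Gm k) ∘ unc`, the averages `QvL (T k)` ONTO, leaf V-P (coarse) at every level, and the UPPER BRACKETS
`Δ_{k+1}(φ) ≤ Δ_k(φ) + e k·nsqV φ` with `0 ≤ e k`, `Σ_{k<K} e k ≤ S` — NO transport identities, NO other leaf: `∃ X∞, Tendsto (k ↦ effV (L^k) M (R k) (Gm k) (QmL (L^k) M (T k)) a) atTop (𝓝 X∞)`,
`X∞` Hermitian with nonnegative form, the block-spin values converge, and `Σ_{k<K} |Δ_k(φ) − Δ_{k+1}(φ)| ≤ Δ_0(φ) + 2S·nsqV φ`. [folklore] -/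
theorem effV_tendsto_of_bracket (hGm : ∀ k, (Gm k).PosSemidef) (hG : ∀ k W, G k W = qform (Gm k) (unc W))
    (hsurj : ∀ k, Function.Surjective (QvL (L ^ k) M (T k)))
    {CP : ℕ → ℝ} (hPc : ∀ k W, qWV (L ^ k) M W ≤ CP k * (ScV (L ^ k) M (R k) (G k) W + nsqV M (QvL (L ^ k) M (T k) W)))
    {a : ℝ} (ha : 0 < a) {e : ℕ → ℝ} {S : ℝ} (he0 : ∀ k, 0 ≤ e k) (hS : ∀ K, ∑ k ∈ range K, e k ≤ S)
    (hup : ∀ k φ, blockSpin (QvL (L ^ (k + 1)) M (T (k + 1))) (ScV (L ^ (k + 1)) M (R (k + 1)) (G (k + 1))) φ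
      ≤ blockSpin (QvL (L ^ k) M (T k)) (ScV (L ^ k) M (R k) (G k)) φ + e k * nsqV M φ) :
    ∃ Xlim : Matrix (Tor M × Fin d) (Tor M × Fin d) ℂ,
      Tendsto (fun k => effV (L ^ k) M (R k) (Gm k) (QmL (L ^ k) M (T k)) a) atTop (𝓝 Xlim) ∧ Xlim.IsHermitian ∧ (∀ v, 0 ≤ qform Xlim v) ∧
      (∀ φ : Tor M → Fin d → ℂ, Tendsto (fun k => blockSpin (QvL (L ^ k) M (T k)) (ScV (L ^ k) M (R k) (G k)) φ) atTop (𝓝 (qform Xlim (unc φ)))) ∧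
      ∀ (φ : Tor M → Fin d → ℂ) (K : ℕ), ∑ k ∈ range K, |blockSpin (QvL (L ^ k) M (T k)) (ScV (L ^ k) M (R k) (G k)) φ
        - blockSpin (QvL (L ^ (k + 1)) M (T (k + 1))) (ScV (L ^ (k + 1)) M (R (k + 1)) (G (k + 1))) φ|
        ≤ blockSpin (QvL (L ^ 0) M (T 0)) (ScV (L ^ 0) M (R 0) (G 0)) φ + 2 * (S * nsqV M φ) := by
  have hG0 : ∀ k W, 0 ≤ G k W := fun k => nonneg_of_qform (L ^ k) M (hGm k) (hG k)
  have hQ : ∀ k, Function.Surjective (QmL (L ^ k) M (T k)).mulVec := fun k => QmL_mulVec_surjective _ _ (hsurj k)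
  have hP' : ∀ k W, qWV (L ^ k) M W ≤ CP k * (ScV (L ^ k) M (R k) (G k) W
      + nsqV M (VariationalVectorEffective.avg (L ^ k) M (QmL (L ^ k) M (T k)) W)) := fun k W => by
    rw [avg_QmL]; exact hPc k W
  have hΔ : ∀ k φ, blockSpin (QvL (L ^ k) M (T k)) (ScV (L ^ k) M (R k) (G k)) φ
      = qform (effV (L ^ k) M (R k) (Gm k) (QmL (L ^ k) M (T k)) a) (unc φ) := fun k φ => by
    rw [← avg_QmL_eq]; exact blockSpin_ScV_eq (L ^ k) M (R k) (hGm k) (hG k) (hQ k) (hP' k) ha φ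
  have hX : ∀ k, (effV (L ^ k) M (R k) (Gm k) (QmL (L ^ k) M (T k)) a).IsHermitian := fun k =>
    effV_isHermitian (L ^ k) M (R k) (hGm k) (hG k) (hQ k) (hP' k) ha
  have hpos : ∀ k v, 0 ≤ qform (effV (L ^ k) M (R k) (Gm k) (QmL (L ^ k) M (T k)) a) v := fun k v => by
    rw [← unc_cur v, ← hΔ]
    exact blockSpin_nonneg' (ScV_nonneg (L ^ k) M (R k) (hG0 k))
  have hstep : ∀ k v, qform (effV (L ^ (k + 1)) M (R (k + 1)) (Gm (k + 1)) (QmL (L ^ (k + 1)) M (T (k + 1))) a) v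
      ≤ qform (effV (L ^ k) M (R k) (Gm k) (QmL (L ^ k) M (T k)) a) v + e k * nsqV M (cur v) := fun k v => by
    rw [← unc_cur v, ← hΔ, ← hΔ]
    exact hup k (cur v)
  obtain ⟨Xlim, hT, hH, hnn, hform⟩ := exists_tendsto_of_upper_brackets (fun k => effV (L ^ k) M (R k) (Gm k) (QmL (L ^ k) M (T k)) a) hX hpos
    (N := fun v => nsqV M (cur v)) (fun v => nsqV_nonneg M (cur v)) he0 hS hstep
  refine ⟨Xlim, hT, hH, hnn, fun φ => ?_, fun φ K => ?_⟩
  · have e1 : (fun k => blockSpin (QvL (L ^ k) M (T k)) (ScV (L ^ k) M (R k) (G k)) φ)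
        = fun k => qform (effV (L ^ k) M (R k) (Gm k) (QmL (L ^ k) M (T k)) a) (unc φ) := funext fun k => hΔ k φ
    rw [e1]
    exact hform (unc φ)
  · exact VariationalMonotoneTower.tv_le_of_le_add (f := fun k => blockSpin (QvL (L ^ k) M (T k)) (ScV (L ^ k) M (R k) (G k)) φ)
      (e := fun k => e k * nsqV M φ) (S := S * nsqV M φ) (fun k => blockSpin_nonneg' (ScV_nonneg (L ^ k) M (R k) (hG0 k)))
      (fun k => mul_nonneg (he0 k) (nsqV_nonneg M φ))
      (fun K => by rw [← sum_mul]; exact mul_le_mul_of_nonneg_right (hS K) (nsqV_nonneg M φ)) (fun k => hup k φ) K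

end Tower

end Summit.QuantumFields.BalabanUV.T4Continuum.VariationalVectorEndMonotone

end
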